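import Summits.ResolutionOfSingularities.ResolutionOfSingularities.Theorems.PurelyInseparableDim4WideTangentMoves
import Summits.ResolutionOfSingularities.ResolutionOfSingularities.Theorems.PurelyInseparableDim4RidgeResidual
import Summits.ResolutionOfSingularities.ResolutionOfSingularities.Theorems.PurelyInseparableDim4IsolatedConeOneFree
import HarnessLib

/-!
# [OURS · res-dim4-pi] THE WIDE CORE IS THE TANGENT ∧ SATELLITE RESIDUE: `NoWideTrap p p` iff there is
  no witnessed isolated `ē ≡ 2` floor chain making infinitely many TANGENT moves AND infinitely many
  SATELLITE moves

Cell `res-dim4-pi` (D-0157 DOOR 2), seat `res-dim4-p-3` (g2); ninth file of the wide-core letter kit.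
The open core of F4-I(p,p) on the floor is `NoWideTrap p p` (p659279; at `p = 3` it IS `E2(3,3)`,
p-12 g2 `noWideTrap_iff_coneTwo`).  Two chain theorems are in the tree: FT — a witnessed isolated chain
makes infinitely many SATELLITE moves (`FreeTailProof.noIsolatedFreeTailAt_self`, p659995) — and the (NT)
chain theorem — an isolated `ē ≡ 2` floor chain makes infinitely many TANGENT moves
(`exists_tangent_move`, p666948).  This file records the conjunction as an EQUIVALENCE: the wide core is
EXACTLY the class of witnessed isolated `ē ≡ 2` floor chains on which tangent moves and satellite moves
both recur for ever — idea-3's located residue `R*` (cards P-3-9 / I-3-14) as the precise open object.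

* `exists_witnesses_of_step0_chain` (Step0 chains ↔ witnessed chains; converse = p-5 `IsolatedBand.step0_of_isWitnessedChain`),
  `exists_isSatellite_of_isolated` (FT, recurrence form), `exists_witnessed_tangent_move` (the (NT) chain
  theorem in witnessed form), **`noWideTrap_iff_no_residue_chain`**.

[OURS · counted 0 · glue; AI kernel work, weaker than expert review.]  Nothing here is a statement about
resolution of singularities; nothing here proves `NoWideTrap` / `E2(3,3)`; resolution in dimension `≥ 4`
/ characteristic `p > 0` is NOT proved by anything in this file.  Host item (DR-157-C):
`stmt-ResolutionOfSingularities-16155`, helper.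
-/

noncomputable section

set_option linter.dupNamespace false -- mandated namespace of this single-conjunct summit

open MvPolynomial Finset
open scoped BigOperators

namespace Summit.ResolutionOfSingularities.ResolutionOfSingularities.Theorems.PIDim4.RidgeBudget

open IsolationCert
open Literature.AlgebraicGeometry
open Literature.AlgebraicGeometry.Resolution
open Literature.AlgebraicGeometry.Resolution.Hauser2010
open Literature.AlgebraicGeometry.Resolution.HauserPerlega2019
open Literature.Barriers.ResolutionOfSingularities
open PointBlowup (direction gradSpan additiveSubspace boundarySubspace)

variable {K : Type} [Field K]

/-! ## §1 Step0 chains versus witnessed chains -/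

/-- A `Step0` chain admits witnesses (charts and points). OURS (bookkeeping, choice). [folklore] -/
theorem exists_witnesses_of_step0_chain [DecidableEq K] {q : ℕ} {c : ℕ → State K}
    (hc : ∀ k, Step0 q (c k) (c (k + 1))) :
    ∃ (j : ℕ → Fin 4) (b : ℕ → Fin 4 → K), FreeTail.IsWitnessedChain q c j b := by
  have h : ∀ k, ∃ (jk : Fin 4) (bk : Fin 4 → K), (q : ℕ∞) ≤ CentreBlowup.ordAlong Finset.univ (c k).F ∧
      bk jk = 0 ∧ CentreBlowup.IsEquimultiplePoint q Finset.univ jk bk (c k) ∧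
      (CentreBlowup.step q Finset.univ jk bk (c k)).F ≠ 0 ∧
      c (k + 1) = CentreBlowup.step q Finset.univ jk bk (c k) := fun k => by
    obtain ⟨hord, jk, bk, -, hbj, heq, hne, hck⟩ := hc k
    exact ⟨jk, bk, hord, hbj, heq, hne, hck⟩
  choose j b hjb using h
  exact ⟨j, b, hjb⟩

/-! ## §2 The two recurrences on a wide isolated floor chain -/

/-- **Satellite recurrence** (FT p659995 in recurrence form): on an all-isolated witnessed `Step0 p`
chain, satellite moves occur beyond every index. OURS (bookkeeping over `noIsolatedFreeTailAt_self`).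
[cite: CossartJannsenSaito2020, Lemma 11.3] -/
theorem exists_isSatellite_of_isolated [DecidableEq K] (p : ℕ) [Fact p.Prime] [CharP K p]
    {c : ℕ → State K} {j : ℕ → Fin 4} {b : ℕ → Fin 4 → K} (hw : FreeTail.IsWitnessedChain p c j b)
    (hiso : ∀ k, IsIsolated p (c k).F) (k₀ : ℕ) : ∃ k, k₀ ≤ k ∧ FreeTail.IsSatellite j b k := by
  by_contra h
  push Not at h
  obtain ⟨k, hk⟩ := FreeTailProof.noIsolatedFreeTailAt_self p K c j b k₀ hw fun k hk => h k hk
  exact hk (hiso k)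

/-- **Tangent recurrence, witnessed form** (the (NT) chain theorem p666948): on an isolated floor chain with
`ē ≡ 2`, beyond every index there is a move `k` whose witnessed direction `e_{j k} + b k` is a zero of a
non-zero degree-`o` tangent-cone form of `c k`. OURS. [cite: CossartJannsenSaito2020, Thm. 9.4] -/
theorem exists_witnessed_tangent_move [DecidableEq K] (p : ℕ) [Fact p.Prime] [CharP K p]
    {c : ℕ → State K} {j : ℕ → Fin 4} {b : ℕ → Fin 4 → K} (hw : FreeTail.IsWitnessedChain p c j b)
    (hiso : ∀ k, IsIsolated p (c k).F) (hord : ∀ k, ordZero (c k).F = p) (hwide : ∀ k, ebar (c k).F = 2)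
    (k₀ : ℕ) :
    ∃ k, k₀ ≤ k ∧ ∃ (a a' : Fin 4) (n : ℕ) (g : MvPolynomial (Fin 4) K), a ≠ a' ∧
      originIdeal K ≤ Ideal.span {(X a : MvPolynomial (Fin 4) K), X a'} ⊔ singLocusIdeal p (c k).F ⊔
        originIdeal K ^ 2 ∧
      2 ≤ n ∧ jetColength p n (c k).F = n * (n + 1) / 2 ∧
      jetColength p (n + 1) (c k).F ≠ (n + 1) * (n + 1 + 1) / 2 ∧
      g ≠ 0 ∧ g.IsHomogeneous n ∧ g ∈ singLocusIdeal p (c k).F ⊔ originIdeal K ^ (n + 1) ∧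
      eval (Function.update (b k) (j k) 1) g = 0 := by
  have hc : ∀ k, Step0 p (c k) (c (k + 1)) := IsolatedBand.step0_of_isWitnessedChain hw
  obtain ⟨k, hk, a, a', n, g, hab, hm, hn2, hn, hn1, hg0, hhom, hgI, hall⟩ :=
    exists_tangent_move_succ p c hc hiso hord hwide k₀
  obtain ⟨-, hbj, heq, -, hck⟩ := hw (k + 1)
  exact ⟨k + 1, by omega, a, a', n, g, hab, hm, hn2, hn, hn1, hg0, hhom, hgI,
    hall (j (k + 1)) (b (k + 1)) hbj heq hck⟩

/-! ## §3 The residue theorem -/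

/-- **THE WIDE CORE IS THE TANGENT ∧ SATELLITE RESIDUE.**  For a prime `p`: `NoWideTrap p p` holds iff
there is NO witnessed `Step0 p` chain of isolated states, all of order `p` with `ē = 2`, that makes
infinitely many TANGENT moves (direction killed by a tangent-cone form of the current fat point) AND
infinitely many SATELLITE moves (chart change without translating the previous exceptional coordinate).
(`⇒` is restriction; `⇐`: every isolated `ē ≡ 2` floor chain has both recurrences — FT p659995 and the
(NT) chain theorem p666948 — so forbidding the residue forbids them all; `noWideTrap_iff_coneTwo`.)
OURS (glue). [cite: CossartJannsenSaito2020, Thm. 9.4 and Lemma 11.3] -/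
theorem noWideTrap_iff_no_residue_chain (p : ℕ) [Fact p.Prime] :
    NoWideTrap p p ↔ ∀ (K : Type) [Field K] [CharP K p] [DecidableEq K],
      ¬ ∃ (c : ℕ → State K) (j : ℕ → Fin 4) (b : ℕ → Fin 4 → K),
        FreeTail.IsWitnessedChain p c j b ∧
        (∀ k, IsIsolated p (c k).F ∧ ordZero (c k).F = p ∧ ebar (c k).F = 2) ∧
        (∀ k₀, ∃ k, k₀ ≤ k ∧ ∃ (a a' : Fin 4) (n : ℕ) (g : MvPolynomial (Fin 4) K), a ≠ a' ∧
          originIdeal K ≤ Ideal.span {(X a : MvPolynomial (Fin 4) K), X a'} ⊔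
            singLocusIdeal p (c k).F ⊔ originIdeal K ^ 2 ∧
          2 ≤ n ∧ jetColength p n (c k).F = n * (n + 1) / 2 ∧
          jetColength p (n + 1) (c k).F ≠ (n + 1) * (n + 1 + 1) / 2 ∧
          g ≠ 0 ∧ g.IsHomogeneous n ∧ g ∈ singLocusIdeal p (c k).F ⊔ originIdeal K ^ (n + 1) ∧
          eval (Function.update (b k) (j k) 1) g = 0) ∧
        (∀ k₀, ∃ k, k₀ ≤ k ∧ FreeTail.IsSatellite j b k) := by
  rw [noWideTrap_iff_coneTwo]
  constructor
  · intro h K _ _ _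
    rintro ⟨c, j, b, hw, hck, -, -⟩
    exact h K ⟨c, fun k => ⟨(hck k).1, IsolatedBand.step0_of_isWitnessedChain hw k, (hck k).2.1, (hck k).2.2⟩⟩
  · intro h K _ _ _
    rintro ⟨c, hc⟩
    obtain ⟨j, b, hw⟩ := exists_witnesses_of_step0_chain (fun k => (hc k).2.1)
    have hiso : ∀ k, IsIsolated p (c k).F := fun k => (hc k).1
    have hord : ∀ k, ordZero (c k).F = p := fun k => (hc k).2.2.1
    have hwide : ∀ k, ebar (c k).F = 2 := fun k => (hc k).2.2.2
    exact h K ⟨c, j, b, hw, fun k => ⟨hiso k, hord k, hwide k⟩,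
      fun k₀ => exists_witnessed_tangent_move p hw hiso hord hwide k₀,
      fun k₀ => exists_isSatellite_of_isolated p hw hiso k₀⟩

end Summit.ResolutionOfSingularities.ResolutionOfSingularities.Theorems.PIDim4.RidgeBudget

end
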